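import Summits.BirchSwinnertonDyer.Rank1Residual.ManinAdditive.PrimeShiftEqualiserLaw
import Summits.BirchSwinnertonDyer.BirchSwinnertonDyer.Theorems.ManinLocalTwoThreeTwoShiftEqualiserHolds
import Summits.BirchSwinnertonDyer.BirchSwinnertonDyer.Theorems.ManinLocalTwoThreeThreeShiftEqualiserAllLevels
import HarnessLib

/-!
# Edges of the PRIME-GENERIC SHIFT EQUALISER LAW: the provers' `TwoShift` dialect is this vocabulary; the instances
# `p = 2`, `p = 3` and `p ∤ N` hold BY NAME; the law reduces to `p ≥ 5`, `p ∣ N` (cell `bsd-f2-manin`, T-p1-g11-2, typer g17)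

Theorem-only sibling of `PrimeShiftEqualiserLaw.lean` (which types `ShiftEqualiser.IsAdd / IsShiftInvariant t / IsDiamond /
RestrictsFrom / ShiftInvariantIsDiamondAt K t N` and the LEAD's law `PrimeShiftInvariantIsDiamond`, `@[conjecture]`, nothing
asserted).  This file may import prover files (`Theorems/ManinLocalTwoThree…`, all outside the theses cone) and proves:
* §1 the `TwoShift` dialect (p3 g11, `Theorems/ManinLocalTwoThreeTwoShiftLaws.lean`, any commutative ring `K`) IS the generic
  vocabulary at `t = 2, 4, 8` — `Iff.rfl`;
* §2 the adapter from the explicit shape to p2's `Gamma0.degeneracyConj` shape at ANY `d` (`apply_degeneracyConj_eq_of_isShiftInvariant`),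
  whence **`p ∤ N`, every prime `p`** (`shiftInvariantIsDiamondAt_of_not_dvd` ⟸ p2 g12 `shiftInvariant_isDiamond`, Serre amalgam);
* §3 level `N = 0` for every `p` (`shiftInvariantIsDiamondAt_level_zero`: `Γ₀(0)` is upper triangular, `(p−1)·φ(T) = −φ(T)`);
* §4 the instances BY NAME: **`primeShiftInvariantIsDiamondAtPrime_two`** (⟸ p3 g11 + p1 g12 + p2 g12:
  `TwoShift.twoShiftInvariantIsDiamond_holds`, G₂ at every level `N ≥ 1`, + §3) and **`primeShiftInvariantIsDiamondAtPrime_three`**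
  (⟸ p1 g11 `threeShiftInvariantIsDiamondAt_all`);
* §5 the REDUCTION: `PrimeShiftInvariantIsDiamond ⟺ ∀ p ≥ 5 prime, ∀ N, p ∣ N → ShiftInvariantIsDiamondAt (ZMod p) p N`
  (`primeShiftInvariantIsDiamond_iff_five_le_dvd`) — the OPEN content of the LEAD's law is exactly the `K_{p,p}` tower at `p ≥ 5`.
HONEST FRAMING: bookkeeping over landed theorems; nothing about BSD, Manin's conjecture or C2/C3 is proved here; the law itself
stays an obligation node.  bears_on: stmt-BirchSwinnertonDyer-22967, stmt-BirchSwinnertonDyer-22968.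
[cite: DarmonDiamondTaylor1995, Lemma 4.28 (p. 135) (degeneracy maps on Γ₀; shape only)]
-/

set_option autoImplicit false

open scoped MatrixGroups

open CongruenceSubgroup Matrix.SpecialLinearGroup
open Summit.BirchSwinnertonDyer.Rank1Residual.ManinAdditive.NineShiftEqualiser (slOf g0Of slOf_apply_00 slOf_apply_01
  slOf_apply_10 slOf_apply_11 slOf_mem_gamma0 g0Of_congr ThreeShiftInvariantIsDiamondAt)
open Literature.NumberTheory.EllipticCurves.ModularForms (Gamma0.degeneracyConj)
open Summit.BirchSwinnertonDyer.BirchSwinnertonDyer.Theorems.ManinLocalTwoThree (gamma0_det_entries g0Of_entries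
  g0Of_unipotent_pow shiftInvariant_isDiamond threeShiftInvariantIsDiamondAt_all)
open Summit.BirchSwinnertonDyer.BirchSwinnertonDyer.Theorems.ManinLocalTwoThree.TwoShift (level_dvd_c
  twoShiftInvariantIsDiamond_holds)

namespace Summit.BirchSwinnertonDyer.Rank1Residual.ManinAdditive.ShiftEqualiser

/-! ### §1. The provers' `TwoShift` dialect is the generic vocabulary (`Iff.rfl`) -/

section TwoShiftDialect

open Summit.BirchSwinnertonDyer.BirchSwinnertonDyer.Theorems.ManinLocalTwoThree

variable {K : Type*} {M N : ℕ}

/-- `TwoShift.IsAdd` is `IsAdd`. [folklore] -/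
theorem twoShift_isAdd_iff [CommRing K] (φ : Gamma0 N → K) : TwoShift.IsAdd φ ↔ IsAdd φ := Iff.rfl

/-- `TwoShift.IsTwoShiftInvariant` is `IsShiftInvariant 2`. [folklore] -/
theorem isTwoShiftInvariant_iff (φ : Gamma0 N → K) : TwoShift.IsTwoShiftInvariant φ ↔ IsShiftInvariant 2 φ := Iff.rfl

/-- `TwoShift.IsFourShiftInvariant` is `IsShiftInvariant 4`. [folklore] -/
theorem isFourShiftInvariant_iff (φ : Gamma0 N → K) : TwoShift.IsFourShiftInvariant φ ↔ IsShiftInvariant 4 φ := Iff.rfl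

/-- `TwoShift.IsEightShiftInvariant` is `IsShiftInvariant 8`. [folklore] -/
theorem isEightShiftInvariant_iff (φ : Gamma0 N → K) : TwoShift.IsEightShiftInvariant φ ↔ IsShiftInvariant 8 φ := Iff.rfl

/-- `TwoShift.IsDiamond` is `IsDiamond`. [folklore] -/
theorem twoShift_isDiamond_iff [CommRing K] (φ : Gamma0 N → K) : TwoShift.IsDiamond φ ↔ IsDiamond φ := Iff.rfl

/-- `TwoShift.RestrictsFrom` is `RestrictsFrom`. [folklore] -/
theorem twoShift_restrictsFrom_iff (φ : Gamma0 N → K) (w : Gamma0 M → K) :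
    TwoShift.RestrictsFrom φ w ↔ RestrictsFrom φ w := Iff.rfl

/-- the provers' single-level G₂ schema is `ShiftInvariantIsDiamondAt (ℤ/2) 2 N`. [folklore] -/
theorem twoShiftInvariantIsDiamondAt_iff (N : ℕ) :
    TwoShift.TwoShiftInvariantIsDiamondAt N ↔ ShiftInvariantIsDiamondAt (ZMod 2) 2 N := Iff.rfl

/-- the provers' law G₂ is the `p = 2` instance of the generic law on positive levels. [folklore] -/
theorem twoShiftInvariantIsDiamond_iff :
    TwoShift.TwoShiftInvariantIsDiamond ↔ ∀ N : ℕ, 0 < N → ShiftInvariantIsDiamondAt (ZMod 2) 2 N := Iff.rfl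

/-- the provers' law G₈ in the generic vocabulary (`t = 8` over `ℤ/2`). [folklore] -/
theorem eightShiftInvariantIsDiamond_iff :
    TwoShift.EightShiftInvariantIsDiamond ↔ ∀ N : ℕ, 0 < N → ShiftInvariantIsDiamondAt (ZMod 2) 8 N := Iff.rfl

end TwoShiftDialect

/-! ### §2. Adapter to the `Gamma0.degeneracyConj` shape; the instance `p ∤ N` for every prime (p2) -/

section Adapter

variable {K : Type*} {N : ℕ}

/-- An explicitly `d`-shift-invariant map takes the same value on the two degeneracy images
`degeneracyConj N (N·d) 1 γ = γ` and `degeneracyConj N (N·d) d γ = diag(d,1) γ diag(d,1)⁻¹` of every `γ ∈ Γ₀(N·d)` — the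
hypothesis shape of p2's `shiftInvariant_isDiamond`. [cite: DarmonDiamondTaylor1995, Lemma 4.28 (p. 135)] -/
theorem apply_degeneracyConj_eq_of_isShiftInvariant (d : ℕ) [NeZero d] (φ : Gamma0 N → K)
    (hinv : IsShiftInvariant (d : ℤ) φ) (γ : Gamma0 (N * d)) :
    φ (Gamma0.degeneracyConj N (N * d) 1 (mul_dvd_mul_left N (one_dvd d)) γ) =
      φ (Gamma0.degeneracyConj N (N * d) d dvd_rfl γ) := by
  have hd0 : (d : ℤ) ≠ 0 := by exact_mod_cast (NeZero.ne d)
  -- `c = d c₀` with `N ∣ c₀`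
  obtain ⟨k, hk⟩ := level_dvd_c γ
  set c₀ : ℤ := (N : ℤ) * k with hc₀def
  have hc₀ : ((γ : SL(2, ℤ)) 1 0 : ℤ) = (d : ℤ) * c₀ := by rw [hk, hc₀def]; push_cast; ring
  have hNc₀ : (N : ℤ) ∣ c₀ := dvd_mul_right _ _
  have hdet : ((γ : SL(2, ℤ)) 0 0 : ℤ) * (γ : SL(2, ℤ)) 1 1 - ((γ : SL(2, ℤ)) 0 1 : ℤ) * ((d : ℤ) * c₀) = 1 := by
    rw [← hc₀]; exact gamma0_det_entries γ
  have e1 : Gamma0.degeneracyConj N (N * d) 1 (mul_dvd_mul_left N (one_dvd d)) γ =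
      g0Of ((γ : SL(2, ℤ)) 0 0) ((γ : SL(2, ℤ)) 0 1) ((d : ℤ) * c₀) ((γ : SL(2, ℤ)) 1 1) hdet
        (Dvd.dvd.mul_left hNc₀ (d : ℤ)) := by
    apply Subtype.ext
    rw [Literature.NumberTheory.EllipticCurves.ModularForms.Gamma0.coe_degeneracyConj_one]
    ext i j
    fin_cases i <;> fin_cases j <;> simp [g0Of, slOf, hc₀]
  have e2 : Gamma0.degeneracyConj N (N * d) d dvd_rfl γ =
      g0Of ((γ : SL(2, ℤ)) 0 0) ((d : ℤ) * (γ : SL(2, ℤ)) 0 1) c₀ ((γ : SL(2, ℤ)) 1 1) (by linear_combination hdet) hNc₀ := by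
    apply Subtype.ext
    ext i j
    have e10 : (d : ℤ) * c₀ / d = c₀ := Int.mul_ediv_cancel_left c₀ hd0
    fin_cases i <;> fin_cases j <;>
      simp [Literature.NumberTheory.EllipticCurves.ModularForms.Gamma0.degeneracyConjElt, g0Of, slOf, hc₀, e10]
  rw [e1, e2]
  exact (hinv _ _ _ _ hdet hNc₀).symm

/-- **`p ∤ N`, EVERY prime `p`** (p2 g12, Serre amalgam in Hom-form): `ShiftInvariantIsDiamondAt (ℤ/p) p N` for
`0 < N`, `p ∤ N` — BY NAME from `ManinLocalTwoThree.shiftInvariant_isDiamond`. [folklore] -/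
theorem shiftInvariantIsDiamondAt_of_not_dvd {p : ℕ} (hp : p.Prime) (hN : 0 < N) (hpN : ¬ p ∣ N) :
    ShiftInvariantIsDiamondAt (ZMod p) p N := by
  haveI : NeZero p := ⟨hp.ne_zero⟩
  haveI : Fact p.Prime := ⟨hp⟩
  intro φ hadd hinv γ hγ
  have hK : ∀ x : ZMod p, p • x = 0 := fun x => by rw [nsmul_eq_mul, ZMod.natCast_self, zero_mul]
  exact shiftInvariant_isDiamond hp hN hpN hK φ hadd
    (fun γ' => apply_degeneracyConj_eq_of_isShiftInvariant p φ hinv γ') γ hγ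

end Adapter

/-! ### §3. Level `N = 0` (harmless but inside the typed law) for every modulus -/

section LevelZero

/-- powers of an additive map into `ℤ/p`: `φ(γⁿ) = n·φ(γ)`. [folklore] -/
private theorem isAdd_map_pow {p N : ℕ} {φ : Gamma0 N → ZMod p} (hφ : IsAdd φ) (γ : Gamma0 N) (n : ℕ) :
    φ (γ ^ n) = n * φ γ := by
  induction n with
  | zero =>
      have h := hφ 1 1
      rw [mul_one] at h
      have h1 : φ 1 = 0 := by
        have h2 : φ 1 + φ 1 = φ 1 + 0 := by rw [add_zero]; exact h.symm
        exact add_left_cancel h2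
      rw [pow_zero, h1, Nat.cast_zero, zero_mul]
  | succ n ih => rw [pow_succ, hφ, ih]; push_cast; ring

/-- **Level `0`, every `p`**: `Γ₀(0)` is the group of upper-triangular matrices, `Γ₁(0) = {(1 b; 0 1)}`, and for an additive
`p`-shift-invariant `φ : Γ₀(0) → ℤ/p` one has `φ(1 pb; 0 1) = φ(1 b; 0 1)`, i.e. `p·x = x` with `p = 0` in `ℤ/p`:
`φ` kills `Γ₁(0)`. (p3's `nineShiftInvariantIsDiamond_zero`, run at any `p`.) [folklore] -/
theorem shiftInvariantIsDiamondAt_level_zero (p : ℕ) : ShiftInvariantIsDiamondAt (ZMod p) p 0 := by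
  intro φ hadd hinv γ hγ
  obtain ⟨h00, h11, h10⟩ := (Gamma1_mem 0 γ).mp hγ
  have e00 : (γ 0 0 : ℤ) = 1 := by
    have := (ZMod.intCast_eq_intCast_iff' (γ 0 0 : ℤ) 1 0).mp (by exact_mod_cast h00)
    simpa using this
  have e11 : (γ 1 1 : ℤ) = 1 := by
    have := (ZMod.intCast_eq_intCast_iff' (γ 1 1 : ℤ) 1 0).mp (by exact_mod_cast h11)
    simpa using this
  have e10 : (γ 1 0 : ℤ) = 0 := by
    have := (ZMod.intCast_zmod_eq_zero_iff_dvd (γ 1 0 : ℤ) 0).mp (by exact_mod_cast h10)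
    simpa using this
  set δ : Gamma0 0 := ⟨γ, Gamma1_in_Gamma0 0 hγ⟩ with hδ
  have hdet := gamma0_det_entries δ
  have hdvd : ((0 : ℕ) : ℤ) ∣ (δ : SL(2, ℤ)) 1 0 := (ZMod.intCast_zmod_eq_zero_iff_dvd _ 0).mp (Gamma0_mem.mp δ.2)
  have eδ : δ = g0Of (M := 0) 1 ((γ 0 1 : ℤ)) 0 1 (by ring) (dvd_refl _) := by
    rw [← g0Of_entries δ hdet hdvd]
    exact g0Of_congr e00 rfl e10 e11 _ _ _ _
  rw [eδ]
  -- `p`-shift invariance at `(1, b, 0, 1)` and additivity on the `p`-th power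
  have key := hinv 1 ((γ 0 1 : ℤ)) 0 1 (by ring) (dvd_refl _)
  have e₁ : g0Of (M := 0) 1 ((γ 0 1 : ℤ)) ((p : ℤ) * 0) 1 (by ring) (Dvd.dvd.mul_left (dvd_refl _) (p : ℤ)) =
      g0Of 1 ((γ 0 1 : ℤ)) 0 1 (by ring) (dvd_refl _) := g0Of_congr rfl rfl (by ring) rfl _ _ _ _
  have e₂ : g0Of (M := 0) 1 ((p : ℤ) * (γ 0 1 : ℤ)) 0 1 (by ring) (dvd_refl _) =
      (g0Of (M := 0) 1 ((γ 0 1 : ℤ)) 0 1 (by ring) (dvd_refl _)) ^ p := by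
    rw [g0Of_unipotent_pow]
  rw [e₁, e₂, isAdd_map_pow hadd, ZMod.natCast_self, zero_mul] at key
  exact key.symm

end LevelZero

/-! ### §4. The instances `p = 2` and `p = 3` hold BY NAME -/

/-- **`p = 3`, EVERY level** — BY NAME from p1 g11 `threeShiftInvariantIsDiamondAt_all` (E-es-96 at every level; Serre base +
cube step + E-es-96). [folklore] -/
theorem primeShiftInvariantIsDiamondAtPrime_three : PrimeShiftInvariantIsDiamondAtPrime 3 :=
  fun N => (threeShiftInvariantIsDiamondAt_iff N).mp (threeShiftInvariantIsDiamondAt_all N)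

/-- **`p = 2`, EVERY level** — BY NAME from the provers' G₂ `TwoShift.twoShiftInvariantIsDiamond_holds` (p3 g11 engine/tower,
p1 g12 index-3 transfer, p2 g12 odd-level base) for `N ≥ 1`, and §3 at `N = 0`. [folklore] -/
theorem primeShiftInvariantIsDiamondAtPrime_two : PrimeShiftInvariantIsDiamondAtPrime 2 := by
  intro N
  rcases Nat.eq_zero_or_pos N with rfl | hN
  · exact shiftInvariantIsDiamondAt_level_zero 2
  · exact (twoShiftInvariantIsDiamondAt_iff N).mp (twoShiftInvariantIsDiamond_holds N hN)

/-- conversely the generic law at `p = 2` gives back the provers' G₂ (bookkeeping). [folklore] -/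
theorem twoShiftInvariantIsDiamond_of_prime (h : PrimeShiftInvariantIsDiamond) :
    Summit.BirchSwinnertonDyer.BirchSwinnertonDyer.Theorems.ManinLocalTwoThree.TwoShift.TwoShiftInvariantIsDiamond :=
  fun N _ => (twoShiftInvariantIsDiamondAt_iff N).mpr (h 2 Nat.prime_two N)

/-! ### §5. Reduction of the law to `p ≥ 5`, `p ∣ N` -/

/-- one prime at a time: the law at `p` follows from its instances at the levels divisible by `p` (the others are p2's
theorem, level `0` is §3). [folklore] -/
theorem primeShiftInvariantIsDiamondAtPrime_of_dvd {p : ℕ} (hp : p.Prime)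
    (h : ∀ N : ℕ, 0 < N → p ∣ N → ShiftInvariantIsDiamondAt (ZMod p) p N) :
    PrimeShiftInvariantIsDiamondAtPrime p := by
  intro N
  rcases Nat.eq_zero_or_pos N with rfl | hN
  · exact shiftInvariantIsDiamondAt_level_zero p
  by_cases hpN : p ∣ N
  · exact h N hN hpN
  · exact shiftInvariantIsDiamondAt_of_not_dvd hp hN hpN

/-- **THE OPEN CONTENT OF THE LEAD'S LAW IS EXACTLY `p ≥ 5`, `p ∣ N`**: `PrimeShiftInvariantIsDiamond` holds iff for every
prime `p ≥ 5` and every level `N ≥ 1` divisible by `p`, `K_p(N) = D(N)` over `ℤ/p`. [folklore] -/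
theorem primeShiftInvariantIsDiamond_iff_five_le_dvd :
    PrimeShiftInvariantIsDiamond ↔
      ∀ p : ℕ, p.Prime → 5 ≤ p → ∀ N : ℕ, 0 < N → p ∣ N → ShiftInvariantIsDiamondAt (ZMod p) p N := by
  constructor
  · exact fun h p hp _ N _ _ => h p hp N
  · intro h p hp
    by_cases h5 : 5 ≤ p
    · exact primeShiftInvariantIsDiamondAtPrime_of_dvd hp (h p hp h5)
    · have h2 := hp.two_le
      interval_cases p
      · exact primeShiftInvariantIsDiamondAtPrime_two
      · exact primeShiftInvariantIsDiamondAtPrime_three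
      · exact absurd hp (by decide)

end Summit.BirchSwinnertonDyer.Rank1Residual.ManinAdditive.ShiftEqualiser
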